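import Literature.Computability.QuantumComplexity.ZXCalculusSwitchShare
import Literature.Computability.QuantumComplexity.ZXCalculusSwitchStates
import HarnessLib

/-!
# ZX-calculus: two consecutive switches with the same / opposite control

JPV'19's `two-consecutive-controlsep-same-control` and `two-consecutive-controlsep-anticontrol` in switch orientation:
`(𝕀 ⊗ Z^{(1,2)}) ⨾ (sw ⊗ 𝕀) ⨾ sw = sw` and `(𝕀 ⊗ (Z^{(1,2)} ⨾ (𝕀 ⊗ X(π)))) ⨾ (sw ⊗ 𝕀) ⨾ sw = sw ⨾ Z^{(1,0)} ⨾ (1/√2 ⊗ X^{(0,1)})`.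
Both follow the printed proofs: share a CNOT between the two copies of the control (`can-share-CNOT` backwards), which the
Hopf law disconnects, leaving the red state `|0⟩` (resp. `|1⟩`) on the second control.
[cite: JeandelPerdrixVilmart2019, Appendix B, Lemmas `two-consecutive-controlsep-same-control`, `two-consecutive-controlsep-anticontrol`]
-/

namespace Literature.Computability.QuantumComplexity

open ZXDiagram

namespace ZXClass

/-- **JPV'19 `two-consecutive-controlsep-same-control`, switch orientation**: two consecutive switches with the same control are one: `(𝕀 ⊗ Z^{(1,2)}) ⨾ (sw ⊗ 𝕀) ⨾ sw = sw` (`(t ∧ ¬x) ∧ ¬x = t ∧ ¬x`). [cite: JeandelPerdrixVilmart2019, Appendix B, Lemma `two-consecutive-controlsep-same-control` and its proof (`can-share-CNOT`, (S1), Hopf law, `red-state-on-controlsep`)] -/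
theorem zsplit_seq_switch_par_seq_switch : mk (wires 1) ⊠ mk (Z 1 2 0) ⨟ mk switch ⊠ mk (wires 1) ⨟ mk switch = mk switch := by
  have s0 : mk (wires 1) ⊠ mk (Z 1 2 0) ⨟ mk switch ⊠ mk (wires 1) ⨟ mk switch = _ := (show mk (wires 1) ⊠ mk (Z 1 2 0) ⨟ mk switch ⊠ mk (wires 1) ⨟ mk switch = mk (wires 1) ⊠ mk (Z 1 2 0) ⨟ (mk switch ⊠ mk (wires 1) ⨟ mk switch) from by simp only [seq_assoc])  -- assoc
  have s1 := s0.trans (cgr (_ : ZXClass 2 3) (show mk switch ⊠ mk (wires 1) ⨟ mk switch = mk (wires 1) ⊠ (mk (Z 1 2 0) ⊠ mk (wires 1) ⨟ mk (wires 1) ⊠ (mk (dumbbell 0 0) ⊠ mk (X 2 1 0))) ⨟ mk switch ⊠ mk (wires 1) ⨟ mk switch from (cnot_seq_switch_par_seq_switch).symm))  -- can_share⁻¹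
  have s2 := s1.trans ((show mk (wires 1) ⊠ mk (Z 1 2 0) ⨟ (mk (wires 1) ⊠ (mk (Z 1 2 0) ⊠ mk (wires 1) ⨟ mk (wires 1) ⊠ (mk (dumbbell 0 0) ⊠ mk (X 2 1 0))) ⨟ mk switch ⊠ mk (wires 1) ⨟ mk switch) = mk (wires 1) ⊠ mk (Z 1 2 0) ⨟ mk (wires 1) ⊠ (mk (Z 1 2 0) ⊠ mk (wires 1) ⨟ mk (wires 1) ⊠ (mk (dumbbell 0 0) ⊠ mk (X 2 1 0))) ⨟ mk switch ⊠ mk (wires 1) ⨟ mk switch from by simp only [seq_assoc]))  -- assoc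
  have s3 := s2.trans (cgl (cgl (show mk (wires 1) ⊠ mk (Z 1 2 0) ⨟ mk (wires 1) ⊠ (mk (Z 1 2 0) ⊠ mk (wires 1) ⨟ mk (wires 1) ⊠ (mk (dumbbell 0 0) ⊠ mk (X 2 1 0))) = mk (wires 1) ⊠ (mk (Z 1 2 0) ⨟ (mk (Z 1 2 0) ⊠ mk (wires 1) ⨟ mk (wires 1) ⊠ (mk (dumbbell 0 0) ⊠ mk (X 2 1 0)))) from (wires_par_seq 1 _ _).symm) (_ : ZXClass 3 2)) (_ : ZXClass 2 1))  -- wires_par_seq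
  have s4 := s3.trans (cgl (cgl (cpr (_ : ZXClass 1 1) (show mk (Z 1 2 0) ⨟ (mk (Z 1 2 0) ⊠ mk (wires 1) ⨟ mk (wires 1) ⊠ (mk (dumbbell 0 0) ⊠ mk (X 2 1 0))) = mk (Z 1 2 0) ⨟ mk (Z 1 2 0) ⊠ mk (wires 1) ⨟ mk (wires 1) ⊠ (mk (dumbbell 0 0) ⊠ mk (X 2 1 0)) from by simp only [seq_assoc])) (_ : ZXClass 3 2)) (_ : ZXClass 2 1))  -- assoc
  have s5 := s4.trans (cgl (cgl (cpr (_ : ZXClass 1 1) (cgl (show mk (Z 1 2 0) ⨟ mk (Z 1 2 0) ⊠ mk (wires 1) = mk (Z 1 3 0) from (Z_seq_Z_par 1 1 1 2 le_rfl 0 0)) (_ : ZXClass 3 2))) (_ : ZXClass 3 2)) (_ : ZXClass 2 1))  -- zsplit_seq_zsplit_par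
  have s6 := s5.trans (cgl (cgl (cpr (_ : ZXClass 1 1) (cgl (show mk (Z 1 3 0) = mk (Z 1 2 0) ⨟ mk (wires 1) ⊠ mk (Z 1 2 0) from ((Z_seq_par_Z 1 1 1 2 le_rfl 0 0)).symm) (_ : ZXClass 3 2))) (_ : ZXClass 3 2)) (_ : ZXClass 2 1))  -- Z12_seq_par_Z12⁻¹
  have s7 := s6.trans (cgl (cgl (cpr (_ : ZXClass 1 1) (cgr (_ : ZXClass 1 3) (show mk (wires 1) ⊠ (mk (dumbbell 0 0) ⊠ mk (X 2 1 0)) = mk (dumbbell 0 0) ⊠ (mk (wires 1) ⊠ mk (X 2 1 0)) from ((par_assoc' _ _ _).trans (cast_id _ _ _)).trans ((cpl (scalar_par_wires _).symm _).trans ((par_assoc _ _ _).trans (cast_id _ _ _)))))) (_ : ZXClass 3 2)) (_ : ZXClass 2 1))  -- scalar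
  have s8 := s7.trans (cgl (cgl (cpr (_ : ZXClass 1 1) (show mk (Z 1 2 0) ⨟ mk (wires 1) ⊠ mk (Z 1 2 0) ⨟ mk (dumbbell 0 0) ⊠ (mk (wires 1) ⊠ mk (X 2 1 0)) = mk (dumbbell 0 0) ⊠ (mk (Z 1 2 0) ⨟ mk (wires 1) ⊠ mk (Z 1 2 0) ⨟ mk (wires 1) ⊠ mk (X 2 1 0)) from by rw [scalar_par_seq_right (mk (dumbbell 0 0)) (mk (Z 1 2 0) ⨟ mk (wires 1) ⊠ mk (Z 1 2 0)) (mk (wires 1) ⊠ mk (X 2 1 0)), empty_par, cast_id])) (_ : ZXClass 3 2)) (_ : ZXClass 2 1))  -- scalar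
  have s9 := s8.trans (cgl (cgl (cpr (_ : ZXClass 1 1) (cpr (_ : ZXClass 0 0) (show mk (Z 1 2 0) ⨟ mk (wires 1) ⊠ mk (Z 1 2 0) ⨟ mk (wires 1) ⊠ mk (X 2 1 0) = mk (Z 1 2 0) ⨟ (mk (wires 1) ⊠ mk (Z 1 2 0) ⨟ mk (wires 1) ⊠ mk (X 2 1 0)) from by simp only [seq_assoc]))) (_ : ZXClass 3 2)) (_ : ZXClass 2 1))  -- assoc
  have s10 := s9.trans (cgl (cgl (cpr (_ : ZXClass 1 1) (cpr (_ : ZXClass 0 0) (cgr (_ : ZXClass 1 2) (show mk (wires 1) ⊠ mk (Z 1 2 0) ⨟ mk (wires 1) ⊠ mk (X 2 1 0) = mk (wires 1) ⊠ (mk (Z 1 2 0) ⨟ mk (X 2 1 0)) from (wires_par_seq 1 _ _).symm)))) (_ : ZXClass 3 2)) (_ : ZXClass 2 1))  -- wires_par_seq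
  have s11 := s10.trans (cgl (cgl (cpr (_ : ZXClass 1 1) (cpr (_ : ZXClass 0 0) (cgr (_ : ZXClass 1 2) (cpr (_ : ZXClass 1 1) (show mk (Z 1 2 0) ⨟ mk (X 2 1 0) = mk invSqrtTwo ⊠ (mk invSqrtTwo ⊠ (mk (Z 1 0 0) ⨟ mk (X 0 1 0))) from split_seq_xmerge_eq_disconnect))))) (_ : ZXClass 3 2)) (_ : ZXClass 2 1))  -- hopf_disconnect
  have s12 := s11.trans (cgl (cgl (cpr (_ : ZXClass 1 1) (cpr (_ : ZXClass 0 0) (cgr (_ : ZXClass 1 2) (show mk (wires 1) ⊠ (mk invSqrtTwo ⊠ (mk invSqrtTwo ⊠ (mk (Z 1 0 0) ⨟ mk (X 0 1 0)))) = mk invSqrtTwo ⊠ (mk (wires 1) ⊠ (mk invSqrtTwo ⊠ (mk (Z 1 0 0) ⨟ mk (X 0 1 0)))) from ((par_assoc' _ _ _).trans (cast_id _ _ _)).trans ((cpl (scalar_par_wires _).symm _).trans ((par_assoc _ _ _).trans (cast_id _ _ _))))))) (_ : ZXClass 3 2)) (_ : ZXClass 2 1))  -- scalar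
  have s13 := s12.trans (cgl (cgl (cpr (_ : ZXClass 1 1) (cpr (_ : ZXClass 0 0) (show mk (Z 1 2 0) ⨟ mk invSqrtTwo ⊠ (mk (wires 1) ⊠ (mk invSqrtTwo ⊠ (mk (Z 1 0 0) ⨟ mk (X 0 1 0)))) = mk invSqrtTwo ⊠ (mk (Z 1 2 0) ⨟ mk (wires 1) ⊠ (mk invSqrtTwo ⊠ (mk (Z 1 0 0) ⨟ mk (X 0 1 0)))) from by rw [scalar_par_seq_right (mk invSqrtTwo) (mk (Z 1 2 0)) (mk (wires 1) ⊠ (mk invSqrtTwo ⊠ (mk (Z 1 0 0) ⨟ mk (X 0 1 0)))), empty_par, cast_id]))) (_ : ZXClass 3 2)) (_ : ZXClass 2 1))  -- scalar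
  have s14 := s13.trans (cgl (cgl (cpr (_ : ZXClass 1 1) (show mk (dumbbell 0 0) ⊠ (mk invSqrtTwo ⊠ (mk (Z 1 2 0) ⨟ mk (wires 1) ⊠ (mk invSqrtTwo ⊠ (mk (Z 1 0 0) ⨟ mk (X 0 1 0))))) = mk (Z 1 2 0) ⨟ mk (wires 1) ⊠ (mk invSqrtTwo ⊠ (mk (Z 1 0 0) ⨟ mk (X 0 1 0))) from sqrt_two_par_invSqrtTwo_par_one_two _)) (_ : ZXClass 3 2)) (_ : ZXClass 2 1))  -- √2·invs2 = 1
  have s15 := s14.trans (cgl (cgl (cpr (_ : ZXClass 1 1) (cgr (_ : ZXClass 1 2) (show mk (wires 1) ⊠ (mk invSqrtTwo ⊠ (mk (Z 1 0 0) ⨟ mk (X 0 1 0))) = mk invSqrtTwo ⊠ (mk (wires 1) ⊠ (mk (Z 1 0 0) ⨟ mk (X 0 1 0))) from ((par_assoc' _ _ _).trans (cast_id _ _ _)).trans ((cpl (scalar_par_wires _).symm _).trans ((par_assoc _ _ _).trans (cast_id _ _ _)))))) (_ : ZXClass 3 2)) (_ : ZXClass 2 1))  -- scalar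
  have s16 := s15.trans (cgl (cgl (cpr (_ : ZXClass 1 1) (show mk (Z 1 2 0) ⨟ mk invSqrtTwo ⊠ (mk (wires 1) ⊠ (mk (Z 1 0 0) ⨟ mk (X 0 1 0))) = mk invSqrtTwo ⊠ (mk (Z 1 2 0) ⨟ mk (wires 1) ⊠ (mk (Z 1 0 0) ⨟ mk (X 0 1 0))) from by rw [scalar_par_seq_right (mk invSqrtTwo) (mk (Z 1 2 0)) (mk (wires 1) ⊠ (mk (Z 1 0 0) ⨟ mk (X 0 1 0))), empty_par, cast_id])) (_ : ZXClass 3 2)) (_ : ZXClass 2 1))  -- scalar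
  have s17 := s16.trans (cgl (cgl (cpr (_ : ZXClass 1 1) (cpr (_ : ZXClass 0 0) (cgr (_ : ZXClass 1 2) (show mk (wires 1) ⊠ (mk (Z 1 0 0) ⨟ mk (X 0 1 0)) = mk (wires 1) ⊠ mk (Z 1 0 0) ⨟ mk (wires 1) ⊠ mk (X 0 1 0) from by simp only [wires_par_seq])))) (_ : ZXClass 3 2)) (_ : ZXClass 2 1))  -- wires_par_seq
  have s18 := s17.trans (cgl (cgl (cpr (_ : ZXClass 1 1) (cpr (_ : ZXClass 0 0) (show mk (Z 1 2 0) ⨟ (mk (wires 1) ⊠ mk (Z 1 0 0) ⨟ mk (wires 1) ⊠ mk (X 0 1 0)) = mk (Z 1 2 0) ⨟ mk (wires 1) ⊠ mk (Z 1 0 0) ⨟ mk (wires 1) ⊠ mk (X 0 1 0) from by simp only [seq_assoc]))) (_ : ZXClass 3 2)) (_ : ZXClass 2 1))  -- assoc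
  have s19 := s18.trans (cgl (cgl (cpr (_ : ZXClass 1 1) (cpr (_ : ZXClass 0 0) (cgl (show mk (Z 1 2 0) ⨟ mk (wires 1) ⊠ mk (Z 1 0 0) = mk (wires 1) from (by rw [Z_seq_par_Z 1 1 1 0 le_rfl]; exact Z_one_one)) (_ : ZXClass 1 2)))) (_ : ZXClass 3 2)) (_ : ZXClass 2 1))  -- Z_split_seq_par_effect
  have s20 := s19.trans (cgl (cgl (cpr (_ : ZXClass 1 1) (cpr (_ : ZXClass 0 0) (show mk (wires 1) ⨟ mk (wires 1) ⊠ mk (X 0 1 0) = mk (wires 1) ⊠ mk (X 0 1 0) from id_seq _))) (_ : ZXClass 3 2)) (_ : ZXClass 2 1))  -- id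
  have s21 := s20.trans (cgl (cgl (show mk (wires 1) ⊠ (mk invSqrtTwo ⊠ (mk (wires 1) ⊠ mk (X 0 1 0))) = mk invSqrtTwo ⊠ (mk (wires 1) ⊠ (mk (wires 1) ⊠ mk (X 0 1 0))) from ((par_assoc' _ _ _).trans (cast_id _ _ _)).trans ((cpl (scalar_par_wires _).symm _).trans ((par_assoc _ _ _).trans (cast_id _ _ _)))) (_ : ZXClass 3 2)) (_ : ZXClass 2 1))  -- scalar
  have s22 := s21.trans (cgl (show mk invSqrtTwo ⊠ (mk (wires 1) ⊠ (mk (wires 1) ⊠ mk (X 0 1 0))) ⨟ mk switch ⊠ mk (wires 1) = mk invSqrtTwo ⊠ (mk (wires 1) ⊠ (mk (wires 1) ⊠ mk (X 0 1 0)) ⨟ mk switch ⊠ mk (wires 1)) from by rw [scalar_par_seq_left (mk invSqrtTwo) (mk (wires 1) ⊠ (mk (wires 1) ⊠ mk (X 0 1 0))) (mk switch ⊠ mk (wires 1)), empty_par, cast_id]) (_ : ZXClass 2 1))  -- scalar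
  have s23 := s22.trans ((show mk invSqrtTwo ⊠ (mk (wires 1) ⊠ (mk (wires 1) ⊠ mk (X 0 1 0)) ⨟ mk switch ⊠ mk (wires 1)) ⨟ mk switch = mk invSqrtTwo ⊠ (mk (wires 1) ⊠ (mk (wires 1) ⊠ mk (X 0 1 0)) ⨟ mk switch ⊠ mk (wires 1) ⨟ mk switch) from by rw [scalar_par_seq_left (mk invSqrtTwo) (mk (wires 1) ⊠ (mk (wires 1) ⊠ mk (X 0 1 0)) ⨟ mk switch ⊠ mk (wires 1)) (mk switch), empty_par, cast_id]))  -- scalar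
  have s24 := s23.trans (cpr (_ : ZXClass 0 0) (cgl (cgl (show mk (wires 1) ⊠ (mk (wires 1) ⊠ mk (X 0 1 0)) = mk (wires 1) ⊠ mk (wires 1) ⊠ mk (X 0 1 0) from (par_assoc' _ _ _).trans (cast_id _ _ _)) (_ : ZXClass 3 2)) (_ : ZXClass 2 1)))  -- par_assoc
  have s25 := s24.trans (cpr (_ : ZXClass 0 0) (cgl (cgl (cpl (show mk (wires 1) ⊠ mk (wires 1) = mk (wires 2) from wires_par_wires 1 1) (_ : ZXClass 0 1)) (_ : ZXClass 3 2)) (_ : ZXClass 2 1)))  -- wires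
  have s26 := s25.trans (cpr (_ : ZXClass 0 0) (cgl (show mk (wires 2) ⊠ mk (X 0 1 0) ⨟ mk switch ⊠ mk (wires 1) = mk switch ⊠ mk (wires 0) ⨟ mk (wires 1) ⊠ mk (X 0 1 0) from (slide _ _).symm) (_ : ZXClass 2 1)))  -- slide
  have s27 := s26.trans (cpr (_ : ZXClass 0 0) (cgl (cgl (show mk switch ⊠ mk (wires 0) = mk switch from par_empty _) (_ : ZXClass 1 2)) (_ : ZXClass 2 1)))  -- par_empty
  have s28 := s27.trans ((show mk invSqrtTwo ⊠ (mk switch ⨟ mk (wires 1) ⊠ mk (X 0 1 0) ⨟ mk switch) = mk invSqrtTwo ⊠ (mk switch ⨟ mk (wires 1) ⊠ mk (X 0 1 0)) ⨟ mk switch from by rw [scalar_par_seq_left (mk invSqrtTwo) (mk switch ⨟ mk (wires 1) ⊠ mk (X 0 1 0)) (mk switch), empty_par, cast_id]))  -- scalar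
  have s29 := s28.trans (cgl (show mk invSqrtTwo ⊠ (mk switch ⨟ mk (wires 1) ⊠ mk (X 0 1 0)) = mk switch ⨟ mk invSqrtTwo ⊠ (mk (wires 1) ⊠ mk (X 0 1 0)) from by rw [scalar_par_seq_right (mk invSqrtTwo) (mk switch) (mk (wires 1) ⊠ mk (X 0 1 0)), empty_par, cast_id]) (_ : ZXClass 2 1))  -- scalar
  have s30 := s29.trans (cgl (cgr (_ : ZXClass 2 1) (show mk invSqrtTwo ⊠ (mk (wires 1) ⊠ mk (X 0 1 0)) = mk (wires 1) ⊠ (mk invSqrtTwo ⊠ mk (X 0 1 0)) from ((par_assoc' _ _ _).trans (cast_id _ _ _)).trans ((cpl (scalar_par_wires _) _).trans ((par_assoc _ _ _).trans (cast_id _ _ _))))) (_ : ZXClass 2 1))  -- scalar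
  have s31 := s30.trans ((show mk switch ⨟ mk (wires 1) ⊠ (mk invSqrtTwo ⊠ mk (X 0 1 0)) ⨟ mk switch = mk switch ⨟ (mk (wires 1) ⊠ (mk invSqrtTwo ⊠ mk (X 0 1 0)) ⨟ mk switch) from by simp only [seq_assoc]))  -- assoc
  have s32 := s31.trans (cgr (_ : ZXClass 2 1) (show mk (wires 1) ⊠ (mk invSqrtTwo ⊠ mk (X 0 1 0)) ⨟ mk switch = mk (wires 1) from par_ket0_seq_switch))  -- par_ket0_seq_switch
  have s33 := s32.trans ((show mk switch ⨟ mk (wires 1) = mk switch from seq_id _))  -- id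
  exact s33

/-- **JPV'19 `two-consecutive-controlsep-anticontrol`, switch orientation (raw form)**: a switch followed by a switch with the negated control annihilates: `(𝕀 ⊗ (Z^{(1,2)} ⨾ (𝕀 ⊗ X(π)))) ⨾ (sw ⊗ 𝕀) ⨾ sw = sw ⨾ Z^{(1,0)} ⨾ (1/√2 ⊗ X^{(0,1)})` (`(t ∧ ¬x) ∧ x = 0`). [cite: JeandelPerdrixVilmart2019, Appendix B, Lemma `two-consecutive-controlsep-anticontrol` and its proof (`can-share-CNOT`, Hopf law, `red-state-on-controlsep`)] -/
theorem zsplit_pi_seq_switch_par_seq_switch : mk (wires 1) ⊠ (mk (Z 1 2 0) ⨟ mk (wires 1) ⊠ mk (X 1 1 4)) ⨟ mk switch ⊠ mk (wires 1) ⨟ mk switch = mk switch ⨟ mk (Z 1 0 0) ⨟ mk invSqrtTwo ⊠ mk (X 0 1 0) := by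
  have s0 : mk (wires 1) ⊠ (mk (Z 1 2 0) ⨟ mk (wires 1) ⊠ mk (X 1 1 4)) ⨟ mk switch ⊠ mk (wires 1) ⨟ mk switch = _ := (show mk (wires 1) ⊠ (mk (Z 1 2 0) ⨟ mk (wires 1) ⊠ mk (X 1 1 4)) ⨟ mk switch ⊠ mk (wires 1) ⨟ mk switch = mk (wires 1) ⊠ (mk (Z 1 2 0) ⨟ mk (wires 1) ⊠ mk (X 1 1 4)) ⨟ (mk switch ⊠ mk (wires 1) ⨟ mk switch) from by simp only [seq_assoc])  -- assoc
  have s1 := s0.trans (cgr (_ : ZXClass 2 3) (show mk switch ⊠ mk (wires 1) ⨟ mk switch = mk (wires 1) ⊠ (mk (Z 1 2 0) ⊠ mk (wires 1) ⨟ mk (wires 1) ⊠ (mk (dumbbell 0 0) ⊠ mk (X 2 1 0))) ⨟ mk switch ⊠ mk (wires 1) ⨟ mk switch from (cnot_seq_switch_par_seq_switch).symm))  -- can_share⁻¹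
  have s2 := s1.trans ((show mk (wires 1) ⊠ (mk (Z 1 2 0) ⨟ mk (wires 1) ⊠ mk (X 1 1 4)) ⨟ (mk (wires 1) ⊠ (mk (Z 1 2 0) ⊠ mk (wires 1) ⨟ mk (wires 1) ⊠ (mk (dumbbell 0 0) ⊠ mk (X 2 1 0))) ⨟ mk switch ⊠ mk (wires 1) ⨟ mk switch) = mk (wires 1) ⊠ (mk (Z 1 2 0) ⨟ mk (wires 1) ⊠ mk (X 1 1 4)) ⨟ mk (wires 1) ⊠ (mk (Z 1 2 0) ⊠ mk (wires 1) ⨟ mk (wires 1) ⊠ (mk (dumbbell 0 0) ⊠ mk (X 2 1 0))) ⨟ mk switch ⊠ mk (wires 1) ⨟ mk switch from by simp only [seq_assoc]))  -- assoc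
  have s3 := s2.trans (cgl (cgl (show mk (wires 1) ⊠ (mk (Z 1 2 0) ⨟ mk (wires 1) ⊠ mk (X 1 1 4)) ⨟ mk (wires 1) ⊠ (mk (Z 1 2 0) ⊠ mk (wires 1) ⨟ mk (wires 1) ⊠ (mk (dumbbell 0 0) ⊠ mk (X 2 1 0))) = mk (wires 1) ⊠ (mk (Z 1 2 0) ⨟ mk (wires 1) ⊠ mk (X 1 1 4) ⨟ (mk (Z 1 2 0) ⊠ mk (wires 1) ⨟ mk (wires 1) ⊠ (mk (dumbbell 0 0) ⊠ mk (X 2 1 0)))) from (wires_par_seq 1 _ _).symm) (_ : ZXClass 3 2)) (_ : ZXClass 2 1))  -- wires_par_seq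
  have s4 := s3.trans (cgl (cgl (cpr (_ : ZXClass 1 1) (show mk (Z 1 2 0) ⨟ mk (wires 1) ⊠ mk (X 1 1 4) ⨟ (mk (Z 1 2 0) ⊠ mk (wires 1) ⨟ mk (wires 1) ⊠ (mk (dumbbell 0 0) ⊠ mk (X 2 1 0))) = mk (Z 1 2 0) ⨟ mk (wires 1) ⊠ mk (X 1 1 4) ⨟ mk (Z 1 2 0) ⊠ mk (wires 1) ⨟ mk (wires 1) ⊠ (mk (dumbbell 0 0) ⊠ mk (X 2 1 0)) from by simp only [seq_assoc])) (_ : ZXClass 3 2)) (_ : ZXClass 2 1))  -- assoc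
  have s5 := s4.trans (cgl (cgl (cpr (_ : ZXClass 1 1) (cgl (show mk (Z 1 2 0) ⨟ mk (wires 1) ⊠ mk (X 1 1 4) ⨟ mk (Z 1 2 0) ⊠ mk (wires 1) = mk (Z 1 2 0) ⨟ (mk (wires 1) ⊠ mk (X 1 1 4) ⨟ mk (Z 1 2 0) ⊠ mk (wires 1)) from by simp only [seq_assoc]) (_ : ZXClass 3 2))) (_ : ZXClass 3 2)) (_ : ZXClass 2 1))  -- assoc
  have s6 := s5.trans (cgl (cgl (cpr (_ : ZXClass 1 1) (cgl (cgr (_ : ZXClass 1 2) (show mk (wires 1) ⊠ mk (X 1 1 4) ⨟ mk (Z 1 2 0) ⊠ mk (wires 1) = mk (Z 1 2 0) ⊠ mk (wires 1) ⨟ mk (wires 2) ⊠ mk (X 1 1 4) from (slide _ _).symm)) (_ : ZXClass 3 2))) (_ : ZXClass 3 2)) (_ : ZXClass 2 1))  -- slide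
  have s7 := s6.trans (cgl (cgl (cpr (_ : ZXClass 1 1) (show mk (Z 1 2 0) ⨟ (mk (Z 1 2 0) ⊠ mk (wires 1) ⨟ mk (wires 2) ⊠ mk (X 1 1 4)) ⨟ mk (wires 1) ⊠ (mk (dumbbell 0 0) ⊠ mk (X 2 1 0)) = mk (Z 1 2 0) ⨟ mk (Z 1 2 0) ⊠ mk (wires 1) ⨟ mk (wires 2) ⊠ mk (X 1 1 4) ⨟ mk (wires 1) ⊠ (mk (dumbbell 0 0) ⊠ mk (X 2 1 0)) from by simp only [seq_assoc])) (_ : ZXClass 3 2)) (_ : ZXClass 2 1))  -- assoc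
  have s8 := s7.trans (cgl (cgl (cpr (_ : ZXClass 1 1) (cgl (cgl (show mk (Z 1 2 0) ⨟ mk (Z 1 2 0) ⊠ mk (wires 1) = mk (Z 1 3 0) from (Z_seq_Z_par 1 1 1 2 le_rfl 0 0)) (_ : ZXClass 3 3)) (_ : ZXClass 3 2))) (_ : ZXClass 3 2)) (_ : ZXClass 2 1))  -- zsplit_seq_zsplit_par
  have s9 := s8.trans (cgl (cgl (cpr (_ : ZXClass 1 1) (cgl (cgl (show mk (Z 1 3 0) = mk (Z 1 2 0) ⨟ mk (wires 1) ⊠ mk (Z 1 2 0) from ((Z_seq_par_Z 1 1 1 2 le_rfl 0 0)).symm) (_ : ZXClass 3 3)) (_ : ZXClass 3 2))) (_ : ZXClass 3 2)) (_ : ZXClass 2 1))  -- Z12_seq_par_Z12⁻¹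
  have s10 := s9.trans (cgl (cgl (cpr (_ : ZXClass 1 1) (cgr (_ : ZXClass 1 3) (show mk (wires 1) ⊠ (mk (dumbbell 0 0) ⊠ mk (X 2 1 0)) = mk (dumbbell 0 0) ⊠ (mk (wires 1) ⊠ mk (X 2 1 0)) from ((par_assoc' _ _ _).trans (cast_id _ _ _)).trans ((cpl (scalar_par_wires _).symm _).trans ((par_assoc _ _ _).trans (cast_id _ _ _)))))) (_ : ZXClass 3 2)) (_ : ZXClass 2 1))  -- scalar
  have s11 := s10.trans (cgl (cgl (cpr (_ : ZXClass 1 1) (show mk (Z 1 2 0) ⨟ mk (wires 1) ⊠ mk (Z 1 2 0) ⨟ mk (wires 2) ⊠ mk (X 1 1 4) ⨟ mk (dumbbell 0 0) ⊠ (mk (wires 1) ⊠ mk (X 2 1 0)) = mk (dumbbell 0 0) ⊠ (mk (Z 1 2 0) ⨟ mk (wires 1) ⊠ mk (Z 1 2 0) ⨟ mk (wires 2) ⊠ mk (X 1 1 4) ⨟ mk (wires 1) ⊠ mk (X 2 1 0)) from by rw [scalar_par_seq_right (mk (dumbbell 0 0)) (mk (Z 1 2 0) ⨟ mk (wires 1)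 ⊠ mk (Z 1 2 0) ⨟ mk (wires 2) ⊠ mk (X 1 1 4)) (mk (wires 1) ⊠ mk (X 2 1 0)), empty_par, cast_id])) (_ : ZXClass 3 2)) (_ : ZXClass 2 1))  -- scalar
  have s12 := s11.trans (cgl (cgl (cpr (_ : ZXClass 1 1) (cpr (_ : ZXClass 0 0) (cgl (cgr (_ : ZXClass 1 3) (cpl (show mk (wires 2) = mk (wires 1) ⊠ mk (wires 1) from (wires_par_wires 1 1).symm) (_ : ZXClass 1 1))) (_ : ZXClass 3 2)))) (_ : ZXClass 3 2)) (_ : ZXClass 2 1))  -- wires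
  have s13 := s12.trans (cgl (cgl (cpr (_ : ZXClass 1 1) (cpr (_ : ZXClass 0 0) (cgl (cgr (_ : ZXClass 1 3) (show mk (wires 1) ⊠ mk (wires 1) ⊠ mk (X 1 1 4) = mk (wires 1) ⊠ (mk (wires 1) ⊠ mk (X 1 1 4)) from (par_assoc _ _ _).trans (cast_id _ _ _))) (_ : ZXClass 3 2)))) (_ : ZXClass 3 2)) (_ : ZXClass 2 1))  -- par_assoc
  have s14 := s13.trans (cgl (cgl (cpr (_ : ZXClass 1 1) (cpr (_ : ZXClass 0 0) (show mk (Z 1 2 0) ⨟ mk (wires 1) ⊠ mk (Z 1 2 0) ⨟ mk (wires 1) ⊠ (mk (wires 1) ⊠ mk (X 1 1 4)) ⨟ mk (wires 1) ⊠ mk (X 2 1 0) = mk (Z 1 2 0) ⨟ mk (wires 1) ⊠ mk (Z 1 2 0) ⨟ (mk (wires 1) ⊠ (mk (wires 1) ⊠ mk (X 1 1 4)) ⨟ mk (wires 1) ⊠ mk (X 2 1 0)) from by simp only [seq_assoc]))) (_ : ZXClass 3 2)) (_ : ZXClass 2 1))  -- assoc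
  have s15 := s14.trans (cgl (cgl (cpr (_ : ZXClass 1 1) (cpr (_ : ZXClass 0 0) (cgr (_ : ZXClass 1 3) (show mk (wires 1) ⊠ (mk (wires 1) ⊠ mk (X 1 1 4)) ⨟ mk (wires 1) ⊠ mk (X 2 1 0) = mk (wires 1) ⊠ (mk (wires 1) ⊠ mk (X 1 1 4) ⨟ mk (X 2 1 0)) from (wires_par_seq 1 _ _).symm)))) (_ : ZXClass 3 2)) (_ : ZXClass 2 1))  -- wires_par_seq
  have s16 := s15.trans (cgl (cgl (cpr (_ : ZXClass 1 1) (cpr (_ : ZXClass 0 0) (cgr (_ : ZXClass 1 3) (cpr (_ : ZXClass 1 1) (show mk (wires 1) ⊠ mk (X 1 1 4) ⨟ mk (X 2 1 0) = mk (X 2 1 4) from (par_X_seq_X 1 1 1 1 le_rfl 0 4)))))) (_ : ZXClass 3 2)) (_ : ZXClass 2 1))  -- par_pi_seq_X21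
  have s17 := s16.trans (cgl (cgl (cpr (_ : ZXClass 1 1) (cpr (_ : ZXClass 0 0) (cgr (_ : ZXClass 1 3) (cpr (_ : ZXClass 1 1) (show mk (X 2 1 4) = mk (X 2 1 0) ⨟ mk (X 1 1 4) from ((X_seq_X 2 1 1 le_rfl 0 4)).symm))))) (_ : ZXClass 3 2)) (_ : ZXClass 2 1))  -- X21_seq_pi⁻¹
  have s18 := s17.trans (cgl (cgl (cpr (_ : ZXClass 1 1) (cpr (_ : ZXClass 0 0) (cgr (_ : ZXClass 1 3) (show mk (wires 1) ⊠ (mk (X 2 1 0) ⨟ mk (X 1 1 4)) = mk (wires 1) ⊠ mk (X 2 1 0) ⨟ mk (wires 1) ⊠ mk (X 1 1 4) from by simp only [wires_par_seq])))) (_ : ZXClass 3 2)) (_ : ZXClass 2 1))  -- wires_par_seq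
  have s19 := s18.trans (cgl (cgl (cpr (_ : ZXClass 1 1) (cpr (_ : ZXClass 0 0) (show mk (Z 1 2 0) ⨟ mk (wires 1) ⊠ mk (Z 1 2 0) ⨟ (mk (wires 1) ⊠ mk (X 2 1 0) ⨟ mk (wires 1) ⊠ mk (X 1 1 4)) = mk (Z 1 2 0) ⨟ mk (wires 1) ⊠ mk (Z 1 2 0) ⨟ mk (wires 1) ⊠ mk (X 2 1 0) ⨟ mk (wires 1) ⊠ mk (X 1 1 4) from by simp only [seq_assoc]))) (_ : ZXClass 3 2)) (_ : ZXClass 2 1))  -- assoc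
  have s20 := s19.trans (cgl (cgl (cpr (_ : ZXClass 1 1) (cpr (_ : ZXClass 0 0) (cgl (show mk (Z 1 2 0) ⨟ mk (wires 1) ⊠ mk (Z 1 2 0) ⨟ mk (wires 1) ⊠ mk (X 2 1 0) = mk (Z 1 2 0) ⨟ (mk (wires 1) ⊠ mk (Z 1 2 0) ⨟ mk (wires 1) ⊠ mk (X 2 1 0)) from by simp only [seq_assoc]) (_ : ZXClass 2 2)))) (_ : ZXClass 3 2)) (_ : ZXClass 2 1))  -- assoc
  have s21 := s20.trans (cgl (cgl (cpr (_ : ZXClass 1 1) (cpr (_ : ZXClass 0 0) (cgl (cgr (_ : ZXClass 1 2) (show mk (wires 1) ⊠ mk (Z 1 2 0) ⨟ mk (wires 1) ⊠ mk (X 2 1 0) = mk (wires 1) ⊠ (mk (Z 1 2 0) ⨟ mk (X 2 1 0)) from (wires_par_seq 1 _ _).symm)) (_ : ZXClass 2 2)))) (_ : ZXClass 3 2)) (_ : ZXClass 2 1))  -- wires_par_seq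
  have s22 := s21.trans (cgl (cgl (cpr (_ : ZXClass 1 1) (cpr (_ : ZXClass 0 0) (cgl (cgr (_ : ZXClass 1 2) (cpr (_ : ZXClass 1 1) (show mk (Z 1 2 0) ⨟ mk (X 2 1 0) = mk invSqrtTwo ⊠ (mk invSqrtTwo ⊠ (mk (Z 1 0 0) ⨟ mk (X 0 1 0))) from split_seq_xmerge_eq_disconnect))) (_ : ZXClass 2 2)))) (_ : ZXClass 3 2)) (_ : ZXClass 2 1))  -- hopf_disconnect
  have s23 := s22.trans (cgl (cgl (cpr (_ : ZXClass 1 1) (cpr (_ : ZXClass 0 0) (cgl (cgr (_ : ZXClass 1 2) (show mk (wires 1) ⊠ (mk invSqrtTwo ⊠ (mk invSqrtTwo ⊠ (mk (Z 1 0 0) ⨟ mk (X 0 1 0)))) = mk invSqrtTwo ⊠ (mk (wires 1) ⊠ (mk invSqrtTwo ⊠ (mk (Z 1 0 0) ⨟ mk (X 0 1 0)))) from ((par_assoc' _ _ _).trans (cast_id _ _ _)).trans ((cpl (scalar_par_wires _).symm _).trans ((par_assoc _ _ _).trans (cast_id _ _ _))))) (_ : ZXClass 2 2)))) (_ : ZXClass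 3 2)) (_ : ZXClass 2 1))  -- scalar
  have s24 := s23.trans (cgl (cgl (cpr (_ : ZXClass 1 1) (cpr (_ : ZXClass 0 0) (cgl (show mk (Z 1 2 0) ⨟ mk invSqrtTwo ⊠ (mk (wires 1) ⊠ (mk invSqrtTwo ⊠ (mk (Z 1 0 0) ⨟ mk (X 0 1 0)))) = mk invSqrtTwo ⊠ (mk (Z 1 2 0) ⨟ mk (wires 1) ⊠ (mk invSqrtTwo ⊠ (mk (Z 1 0 0) ⨟ mk (X 0 1 0)))) from by rw [scalar_par_seq_right (mk invSqrtTwo) (mk (Z 1 2 0)) (mk (wires 1) ⊠ (mk invSqrtTwo ⊠ (mk (Z 1 0 0) ⨟ mk (X 0 1 0)))), empty_par, cast_id]) (_ : ZXClass 2 2)))) (_ : ZXClass 3 2)) (_ : ZXClass 2 1))  -- scalar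
  have s25 := s24.trans (cgl (cgl (cpr (_ : ZXClass 1 1) (cpr (_ : ZXClass 0 0) (show mk invSqrtTwo ⊠ (mk (Z 1 2 0) ⨟ mk (wires 1) ⊠ (mk invSqrtTwo ⊠ (mk (Z 1 0 0) ⨟ mk (X 0 1 0)))) ⨟ mk (wires 1) ⊠ mk (X 1 1 4) = mk invSqrtTwo ⊠ (mk (Z 1 2 0) ⨟ mk (wires 1) ⊠ (mk invSqrtTwo ⊠ (mk (Z 1 0 0) ⨟ mk (X 0 1 0))) ⨟ mk (wires 1) ⊠ mk (X 1 1 4)) from by rw [scalar_par_seq_left (mk invSqrtTwo) (mk (Z 1 2 0) ⨟ mk (wires 1) ⊠ (mk invSqrtTwo ⊠ (mk (Z 1 0 0) ⨟ mk (X 0 1 0)))) (mk (wires 1) ⊠ mk (X 1 1 4)), empty_par, cast_id]))) (_ : ZXClass 3 2)) (_ : ZXClass 2 1))  -- scalar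
  have s26 := s25.trans (cgl (cgl (cpr (_ : ZXClass 1 1) (show mk (dumbbell 0 0) ⊠ (mk invSqrtTwo ⊠ (mk (Z 1 2 0) ⨟ mk (wires 1) ⊠ (mk invSqrtTwo ⊠ (mk (Z 1 0 0) ⨟ mk (X 0 1 0))) ⨟ mk (wires 1) ⊠ mk (X 1 1 4))) = mk (Z 1 2 0) ⨟ mk (wires 1) ⊠ (mk invSqrtTwo ⊠ (mk (Z 1 0 0) ⨟ mk (X 0 1 0))) ⨟ mk (wires 1) ⊠ mk (X 1 1 4) from sqrt_two_par_invSqrtTwo_par_one_two _)) (_ : ZXClass 3 2)) (_ : ZXClass 2 1))  -- √2·invs2 = 1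
  have s27 := s26.trans (cgl (cgl (cpr (_ : ZXClass 1 1) (cgl (cgr (_ : ZXClass 1 2) (show mk (wires 1) ⊠ (mk invSqrtTwo ⊠ (mk (Z 1 0 0) ⨟ mk (X 0 1 0))) = mk invSqrtTwo ⊠ (mk (wires 1) ⊠ (mk (Z 1 0 0) ⨟ mk (X 0 1 0))) from ((par_assoc' _ _ _).trans (cast_id _ _ _)).trans ((cpl (scalar_par_wires _).symm _).trans ((par_assoc _ _ _).trans (cast_id _ _ _))))) (_ : ZXClass 2 2))) (_ : ZXClass 3 2)) (_ : ZXClass 2 1))  -- scalar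
  have s28 := s27.trans (cgl (cgl (cpr (_ : ZXClass 1 1) (cgl (show mk (Z 1 2 0) ⨟ mk invSqrtTwo ⊠ (mk (wires 1) ⊠ (mk (Z 1 0 0) ⨟ mk (X 0 1 0))) = mk invSqrtTwo ⊠ (mk (Z 1 2 0) ⨟ mk (wires 1) ⊠ (mk (Z 1 0 0) ⨟ mk (X 0 1 0))) from by rw [scalar_par_seq_right (mk invSqrtTwo) (mk (Z 1 2 0)) (mk (wires 1) ⊠ (mk (Z 1 0 0) ⨟ mk (X 0 1 0))), empty_par, cast_id]) (_ : ZXClass 2 2))) (_ : ZXClass 3 2)) (_ : ZXClass 2 1))  -- scalar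
  have s29 := s28.trans (cgl (cgl (cpr (_ : ZXClass 1 1) (show mk invSqrtTwo ⊠ (mk (Z 1 2 0) ⨟ mk (wires 1) ⊠ (mk (Z 1 0 0) ⨟ mk (X 0 1 0))) ⨟ mk (wires 1) ⊠ mk (X 1 1 4) = mk invSqrtTwo ⊠ (mk (Z 1 2 0) ⨟ mk (wires 1) ⊠ (mk (Z 1 0 0) ⨟ mk (X 0 1 0)) ⨟ mk (wires 1) ⊠ mk (X 1 1 4)) from by rw [scalar_par_seq_left (mk invSqrtTwo) (mk (Z 1 2 0) ⨟ mk (wires 1) ⊠ (mk (Z 1 0 0) ⨟ mk (X 0 1 0))) (mk (wires 1) ⊠ mk (X 1 1 4)), empty_par, cast_id])) (_ : ZXClass 3 2)) (_ : ZXClass 2 1))  -- scalar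
  have s30 := s29.trans (cgl (cgl (cpr (_ : ZXClass 1 1) (cpr (_ : ZXClass 0 0) (cgl (cgr (_ : ZXClass 1 2) (show mk (wires 1) ⊠ (mk (Z 1 0 0) ⨟ mk (X 0 1 0)) = mk (wires 1) ⊠ mk (Z 1 0 0) ⨟ mk (wires 1) ⊠ mk (X 0 1 0) from by simp only [wires_par_seq])) (_ : ZXClass 2 2)))) (_ : ZXClass 3 2)) (_ : ZXClass 2 1))  -- wires_par_seq
  have s31 := s30.trans (cgl (cgl (cpr (_ : ZXClass 1 1) (cpr (_ : ZXClass 0 0) (show mk (Z 1 2 0) ⨟ (mk (wires 1) ⊠ mk (Z 1 0 0) ⨟ mk (wires 1) ⊠ mk (X 0 1 0)) ⨟ mk (wires 1) ⊠ mk (X 1 1 4) = mk (Z 1 2 0) ⨟ mk (wires 1) ⊠ mk (Z 1 0 0) ⨟ mk (wires 1) ⊠ mk (X 0 1 0) ⨟ mk (wires 1) ⊠ mk (X 1 1 4) from by simp only [seq_assoc]))) (_ : ZXClass 3 2)) (_ : ZXClass 2 1))  -- assoc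
  have s32 := s31.trans (cgl (cgl (cpr (_ : ZXClass 1 1) (cpr (_ : ZXClass 0 0) (cgl (cgl (show mk (Z 1 2 0) ⨟ mk (wires 1) ⊠ mk (Z 1 0 0) = mk (wires 1) from (by rw [Z_seq_par_Z 1 1 1 0 le_rfl]; exact Z_one_one)) (_ : ZXClass 1 2)) (_ : ZXClass 2 2)))) (_ : ZXClass 3 2)) (_ : ZXClass 2 1))  -- Z_split_seq_par_effect
  have s33 := s32.trans (cgl (cgl (cpr (_ : ZXClass 1 1) (cpr (_ : ZXClass 0 0) (cgl (show mk (wires 1) ⨟ mk (wires 1) ⊠ mk (X 0 1 0) = mk (wires 1) ⊠ mk (X 0 1 0) from id_seq _) (_ : ZXClass 2 2)))) (_ : ZXClass 3 2)) (_ : ZXClass 2 1))  -- id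
  have s34 := s33.trans (cgl (cgl (cpr (_ : ZXClass 1 1) (cpr (_ : ZXClass 0 0) (show mk (wires 1) ⊠ mk (X 0 1 0) ⨟ mk (wires 1) ⊠ mk (X 1 1 4) = mk (wires 1) ⊠ (mk (X 0 1 0) ⨟ mk (X 1 1 4)) from (wires_par_seq 1 _ _).symm))) (_ : ZXClass 3 2)) (_ : ZXClass 2 1))  -- wires_par_seq
  have s35 := s34.trans (cgl (cgl (cpr (_ : ZXClass 1 1) (cpr (_ : ZXClass 0 0) (cpr (_ : ZXClass 1 1) (show mk (X 0 1 0) ⨟ mk (X 1 1 4) = mk (X 0 1 4) from (X_seq_X 0 1 1 le_rfl 0 4))))) (_ : ZXClass 3 2)) (_ : ZXClass 2 1))  -- X01_seq_pi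
  have s36 := s35.trans (cgl (cgl (show mk (wires 1) ⊠ (mk invSqrtTwo ⊠ (mk (wires 1) ⊠ mk (X 0 1 4))) = mk invSqrtTwo ⊠ (mk (wires 1) ⊠ (mk (wires 1) ⊠ mk (X 0 1 4))) from ((par_assoc' _ _ _).trans (cast_id _ _ _)).trans ((cpl (scalar_par_wires _).symm _).trans ((par_assoc _ _ _).trans (cast_id _ _ _)))) (_ : ZXClass 3 2)) (_ : ZXClass 2 1))  -- scalar
  have s37 := s36.trans (cgl (show mk invSqrtTwo ⊠ (mk (wires 1) ⊠ (mk (wires 1) ⊠ mk (X 0 1 4))) ⨟ mk switch ⊠ mk (wires 1) = mk invSqrtTwo ⊠ (mk (wires 1) ⊠ (mk (wires 1) ⊠ mk (X 0 1 4)) ⨟ mk switch ⊠ mk (wires 1)) from by rw [scalar_par_seq_left (mk invSqrtTwo) (mk (wires 1) ⊠ (mk (wires 1) ⊠ mk (X 0 1 4))) (mk switch ⊠ mk (wires 1)), empty_par, cast_id]) (_ : ZXClass 2 1))  -- scalar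
  have s38 := s37.trans ((show mk invSqrtTwo ⊠ (mk (wires 1) ⊠ (mk (wires 1) ⊠ mk (X 0 1 4)) ⨟ mk switch ⊠ mk (wires 1)) ⨟ mk switch = mk invSqrtTwo ⊠ (mk (wires 1) ⊠ (mk (wires 1) ⊠ mk (X 0 1 4)) ⨟ mk switch ⊠ mk (wires 1) ⨟ mk switch) from by rw [scalar_par_seq_left (mk invSqrtTwo) (mk (wires 1) ⊠ (mk (wires 1) ⊠ mk (X 0 1 4)) ⨟ mk switch ⊠ mk (wires 1)) (mk switch), empty_par, cast_id]))  -- scalar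
  have s39 := s38.trans (cpr (_ : ZXClass 0 0) (cgl (cgl (show mk (wires 1) ⊠ (mk (wires 1) ⊠ mk (X 0 1 4)) = mk (wires 1) ⊠ mk (wires 1) ⊠ mk (X 0 1 4) from (par_assoc' _ _ _).trans (cast_id _ _ _)) (_ : ZXClass 3 2)) (_ : ZXClass 2 1)))  -- par_assoc
  have s40 := s39.trans (cpr (_ : ZXClass 0 0) (cgl (cgl (cpl (show mk (wires 1) ⊠ mk (wires 1) = mk (wires 2) from wires_par_wires 1 1) (_ : ZXClass 0 1)) (_ : ZXClass 3 2)) (_ : ZXClass 2 1)))  -- wires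
  have s41 := s40.trans (cpr (_ : ZXClass 0 0) (cgl (show mk (wires 2) ⊠ mk (X 0 1 4) ⨟ mk switch ⊠ mk (wires 1) = mk switch ⊠ mk (wires 0) ⨟ mk (wires 1) ⊠ mk (X 0 1 4) from (slide _ _).symm) (_ : ZXClass 2 1)))  -- slide
  have s42 := s41.trans (cpr (_ : ZXClass 0 0) (cgl (cgl (show mk switch ⊠ mk (wires 0) = mk switch from par_empty _) (_ : ZXClass 1 2)) (_ : ZXClass 2 1)))  -- par_empty
  have s43 := s42.trans ((show mk invSqrtTwo ⊠ (mk switch ⨟ mk (wires 1) ⊠ mk (X 0 1 4) ⨟ mk switch) = mk invSqrtTwo ⊠ (mk switch ⨟ mk (wires 1) ⊠ mk (X 0 1 4)) ⨟ mk switch from by rw [scalar_par_seq_left (mk invSqrtTwo) (mk switch ⨟ mk (wires 1) ⊠ mk (X 0 1 4)) (mk switch), empty_par, cast_id]))  -- scalar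
  have s44 := s43.trans (cgl (show mk invSqrtTwo ⊠ (mk switch ⨟ mk (wires 1) ⊠ mk (X 0 1 4)) = mk switch ⨟ mk invSqrtTwo ⊠ (mk (wires 1) ⊠ mk (X 0 1 4)) from by rw [scalar_par_seq_right (mk invSqrtTwo) (mk switch) (mk (wires 1) ⊠ mk (X 0 1 4)), empty_par, cast_id]) (_ : ZXClass 2 1))  -- scalar
  have s45 := s44.trans (cgl (cgr (_ : ZXClass 2 1) (show mk invSqrtTwo ⊠ (mk (wires 1) ⊠ mk (X 0 1 4)) = mk (wires 1) ⊠ (mk invSqrtTwo ⊠ mk (X 0 1 4)) from ((par_assoc' _ _ _).trans (cast_id _ _ _)).trans ((cpl (scalar_par_wires _) _).trans ((par_assoc _ _ _).trans (cast_id _ _ _))))) (_ : ZXClass 2 1))  -- scalar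
  have s46 := s45.trans ((show mk switch ⨟ mk (wires 1) ⊠ (mk invSqrtTwo ⊠ mk (X 0 1 4)) ⨟ mk switch = mk switch ⨟ (mk (wires 1) ⊠ (mk invSqrtTwo ⊠ mk (X 0 1 4)) ⨟ mk switch) from by simp only [seq_assoc]))  -- assoc
  have s47 := s46.trans (cgr (_ : ZXClass 2 1) (show mk (wires 1) ⊠ (mk invSqrtTwo ⊠ mk (X 0 1 4)) ⨟ mk switch = mk (Z 1 0 0) ⨟ mk invSqrtTwo ⊠ mk (X 0 1 0) from par_ket1_seq_switch))  -- par_ket1_seq_switch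
  have s48 := s47.trans ((show mk switch ⨟ (mk (Z 1 0 0) ⨟ mk invSqrtTwo ⊠ mk (X 0 1 0)) = mk switch ⨟ mk (Z 1 0 0) ⨟ mk invSqrtTwo ⊠ mk (X 0 1 0) from by simp only [seq_assoc]))  -- assoc
  exact s48


end ZXClass

end Literature.Computability.QuantumComplexity
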